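import Summits.HodgeConjecture.HodgeCM.Literature.RealApproximation_2

/-! PORT of `HodgeCM/Literature/RealApproximation.lean` (HodgeCMPerL run 82) — part 3: continuation of `Summits.HodgeConjecture.HodgeCM.Literature.RealApproximation_2` (split at a top-level declaration boundary by port_pkg.py; scope re-opened below; declarations unchanged). -/

-- port_pkg: scope re-opened for this part (file-level context, then the namespace/section stack open at the cut)
set_option autoImplicit false
noncomputable section
open NumberField NumberField.InfinitePlace Topology Matrix
open Literature.AlgebraicGeometry.ShimuraVarieties
namespace HodgeCM.Literature
namespace RealApproximation
section MatrixDensity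
variable (L : CMField) (ι₁ : L →+* ℂ) {m : Type*} [Fintype m] [DecidableEq m]
/-- Elements of `U(H)` (`H` invertible) have non-zero determinant. -/
theorem det_ne_zero_of_unitary {Hc v : Matrix m m ℂ} (hH : IsUnit Hc.det) (hv : vᴴ * Hc * v = Hc) : v.det ≠ 0 := by
  intro h0
  have := congrArg Matrix.det hv
  rw [Matrix.det_mul, Matrix.det_mul, h0, mul_zero] at this
  exact hH.ne_zero this.symm

/-- **Part E.** For `h` hermitian and non-degenerate, every `u ∈ U(h^{ι₁})` (complex points) is a limit of `ι₁`-images of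
elements of `U(h)(L₀) = unitaryGroup σ h`. -/
theorem unitary_mem_closure (Hm : Matrix m m L) (hH : (Hm.map ι₁)ᴴ = Hm.map ι₁) (hdet : IsUnit (Hm.map ι₁).det)
    (u : Matrix m m ℂ) (hu : uᴴ * Hm.map ι₁ * u = Hm.map ι₁) :
    u ∈ closure {x : Matrix m m ℂ | ∃ g : GL m L, g ∈ unitaryGroup (conjRingHomK L) Hm ∧ (g : Matrix m m L).map ι₁ = x} := by
  classical
  set Hc := Hm.map ι₁ with hHc
  -- Part D: a unit scalar `α = ι₁ a` with `α + u` invertible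
  obtain ⟨a, ha, hA⟩ := exists_normOne_isUnit L ι₁ u
  set α : ℂ := ι₁ a with hαd
  have hα : starRingEnd ℂ α * α = 1 := conj_mul_of_mem_normOne L ι₁ ha
  have hα0 : α ≠ 0 := ne_zero_of_mem_normOne L ι₁ ha
  -- Part C: inverse Cayley transform `X` of `u`
  set X : Matrix m m ℂ := (α • (1 : Matrix m m ℂ) + u)⁻¹ * (α • 1 - u) with hXd
  have hXlie : Xᴴ * Hc + Hc * X = 0 := cayleyInv_mem_lie hu hα hA
  obtain ⟨h1X, hcay⟩ := cayleyInv_eq (u := u) hα0 hA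
  -- Part B: `X` is a limit of `ι₁`-images of `Lie U(h)(L₀)`, also inside the open set `{det(1 + ·) ≠ 0}`
  have hXc : X ∈ closure ((fun Y : Matrix m m L => Y.map ι₁) '' lieSet (m := m) L ι₁ Hm) :=
    lie_mem_closure L ι₁ Hm hH hdet X hXlie
  let O : Set (Matrix m m ℂ) := {M | (1 + M).det ≠ 0}
  have hO : IsOpen O :=
    isOpen_ne.preimage ((continuous_const.add continuous_id).matrix_det)
  have hXO : X ∈ O := h1X.ne_zero
  have hXc' : X ∈ closure (O ∩ (fun Y : Matrix m m L => Y.map ι₁) '' lieSet (m := m) L ι₁ Hm) :=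
    hO.inter_closure ⟨hXO, hXc⟩
  -- the Cayley map is continuous at `X`
  let c : Matrix m m ℂ → Matrix m m ℂ := fun M => α • ((1 - M) * (1 + M)⁻¹)
  have hc : ContinuousAt c X := by
    have h1 : ContinuousAt (fun M : Matrix m m ℂ => (1 + M)⁻¹) X := by
      have hi : ContinuousAt Ring.inverse (1 + X).det := by
        rw [Ring.inverse_eq_inv']
        exact continuousAt_inv₀ h1X.ne_zero
      exact (continuousAt_matrix_inv (1 + X) hi).comp (continuous_const.add continuous_id).continuousAt
    exact ((continuous_const.sub continuous_id).continuousAt.mul h1).const_smul α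
  have hmem : c X ∈ closure (c '' (O ∩ (fun Y : Matrix m m L => Y.map ι₁) '' lieSet (m := m) L ι₁ Hm)) :=
    ContinuousWithinAt.mem_closure_image hc.continuousWithinAt hXc'
  have hcX : c X = u := hcay
  rw [hcX] at hmem
  refine closure_mono ?_ hmem
  -- the Cayley image of an `L`-rational Lie element with `det(1 + ·) ≠ 0` is the `ι₁`-image of an element of `U(h)(L₀)`
  rintro _ ⟨M, ⟨hMO, ⟨Y, hY, rfl⟩⟩, rfl⟩
  have hY' : (Y.map ι₁)ᴴ * Hc + Hc * Y.map ι₁ = 0 := hY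
  have h1M : IsUnit (1 + Y.map ι₁).det := isUnit_iff_ne_zero.mpr hMO
  -- over `L`: `1 + Y` is invertible
  have h1Y : IsUnit (1 + Y).det := by
    rw [isUnit_iff_ne_zero]
    intro h0
    apply hMO
    have := RingHom.map_det ι₁ (1 + Y)
    rw [h0, map_zero, RingHom.mapMatrix_apply, Matrix.map_add ι₁ (map_add ι₁),
      Matrix.map_one ι₁ (map_zero ι₁) (map_one ι₁)] at this
    exact this.symm
  set gM : Matrix m m L := a • ((1 - Y) * (1 + Y)⁻¹) with hgM
  have hgMmap : gM.map ι₁ = c (Y.map ι₁) := by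
    have hsmul : ∀ N : Matrix m m L, (a • N).map ι₁ = ι₁ a • N.map ι₁ := by
      intro N; ext i j; simp
    rw [hgM, hsmul, Matrix.map_mul, map_nonsing_inv_eq L ι₁ _ h1Y, Matrix.map_sub ι₁ (map_sub ι₁),
      Matrix.map_add ι₁ (map_add ι₁), Matrix.map_one ι₁ (map_zero ι₁) (map_one ι₁)]
  have hcmem : (c (Y.map ι₁))ᴴ * Hc * c (Y.map ι₁) = Hc := cayley_mem hY' h1M hα
  have hgdet : gM.det ≠ 0 := by
    intro h0
    have := RingHom.map_det ι₁ gM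
    rw [h0, map_zero, RingHom.mapMatrix_apply, hgMmap] at this
    exact det_ne_zero_of_unitary hdet hcmem this.symm
  refine ⟨Matrix.GeneralLinearGroup.mkOfDetNeZero gM hgdet, ?_, ?_⟩
  · rw [Literature.AlgebraicGeometry.ShimuraVarieties.mem_unitaryGroup_iff]
    apply Matrix.map_injective ι₁.injective
    change (((gM.map (conjRingHomK L))ᵀ * Hm * gM).map ι₁) = Hm.map ι₁
    rw [Matrix.map_mul, Matrix.map_mul, ← conjTranspose_map_eq', hgMmap, ← hHc, hcmem]
  · change gM.map ι₁ = c (Y.map ι₁)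
    exact hgMmap

end MatrixDensity

/-! #### Part F — transport to `U(2,1)` (the `Units` topology of `GL₃(ℂ)`) -/

section Transport

open HodgeCM.PerL34.BallModel

/-- `val : GL₃(ℂ) → M₃(ℂ)` is a topological embedding (matrix inversion is continuous on invertible matrices). -/
theorem isEmbedding_units_val : Topology.IsEmbedding (Units.val : (Matrix (Fin 3) (Fin 3) ℂ)ˣ → Matrix (Fin 3) (Fin 3) ℂ) := by
  refine Units.isEmbedding_val_mk' (f := fun A : Matrix (Fin 3) (Fin 3) ℂ => A⁻¹) ?_ ?_
  · intro A hA
    have hA' : IsUnit A.det := (Matrix.isUnit_iff_isUnit_det A).mp hA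
    have hi : ContinuousAt Ring.inverse A.det := by
      rw [Ring.inverse_eq_inv']
      exact continuousAt_inv₀ hA'.ne_zero
    exact (continuousAt_matrix_inv A hi).continuousWithinAt
  · intro u
    exact (Matrix.coe_units_inv u).symm

/-- `mat : U(2,1) → M₃(ℂ)` is inducing. -/
theorem isInducing_mat : Topology.IsInducing (mat : U21 → Matrix (Fin 3) (Fin 3) ℂ) :=
  isEmbedding_units_val.isInducing.comp Topology.IsInducing.subtypeVal

variable {L : CMField} {ι₁ : L →+* ℂ}

/-- `h^{ι₁}` is hermitian. -/
theorem conjTranspose_Hm_map (V : HermSpace3 L ι₁) : (V.Hm.map ι₁)ᴴ = V.Hm.map ι₁ := by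
  ext i j
  simp only [Matrix.conjTranspose_apply, Matrix.map_apply, Complex.star_def, ← embedding_conjRingHomK L ι₁,
    V.isHermitian j i]

/-- `h^{ι₁}` is non-degenerate (it has a Sylvester frame). -/
theorem isUnit_det_Hm_map (V : HermSpace3 L ι₁) (T : GL (Fin 3) ℂ)
    (hT : (T : Matrix (Fin 3) (Fin 3) ℂ)ᴴ * V.Hm.map ι₁ * (T : Matrix (Fin 3) (Fin 3) ℂ) = signatureMatrix 2) :
    IsUnit (V.Hm.map ι₁).det := by
  rw [isUnit_iff_ne_zero]
  intro h0
  have := congrArg Matrix.det hT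
  rw [Matrix.det_mul, Matrix.det_mul, h0, mul_zero, zero_mul, signatureMatrix_two_eq_J, det_J] at this
  norm_num at this

/-- **RA-U holds** (KERNEL): the image of `G_U(L₀) = U(h)(L₀)` under `g ↦ T⁻¹ g^{ι₁} T` is dense in `U(2,1)`. -/
theorem _root_.HodgeCM.Literature.RealApproximation_GU_holds : RealApproximation_GU := by
  intro L ι₁ V T hT g0
  classical
  set Hc := V.Hm.map ι₁ with hHc
  set Tm : Matrix (Fin 3) (Fin 3) ℂ := (T : Matrix (Fin 3) (Fin 3) ℂ) with hTm
  set Ti : Matrix (Fin 3) (Fin 3) ℂ := ((T⁻¹ : GL (Fin 3) ℂ) : Matrix (Fin 3) (Fin 3) ℂ) with hTi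
  have hTT : Tm * Ti = 1 := by rw [hTm, hTi, ← Units.val_mul, mul_inv_cancel, Units.val_one]
  have hTT' : Ti * Tm = 1 := by rw [hTm, hTi, ← Units.val_mul, inv_mul_cancel, Units.val_one]
  have hT' : Tmᴴ * Hc * Tm = HodgeCM.PerL34.BallModel.J := hT.trans signatureMatrix_two_eq_J
  have hH : Hcᴴ = Hc := conjTranspose_Hm_map V
  have hdet : IsUnit Hc.det := isUnit_det_Hm_map V T hT
  -- `Tiᴴ J Ti = Hc`
  have hHc' : Tiᴴ * HodgeCM.PerL34.BallModel.J * Ti = Hc := by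
    calc Tiᴴ * HodgeCM.PerL34.BallModel.J * Ti = Tiᴴ * (Tmᴴ * Hc * Tm) * Ti := by rw [hT']
      _ = (Tm * Ti)ᴴ * Hc * (Tm * Ti) := by simp only [Matrix.conjTranspose_mul, Matrix.mul_assoc]
      _ = Hc := by rw [hTT]; simp
  -- `u := T g₀ T⁻¹ ∈ U(h^{ι₁})`
  set u : Matrix (Fin 3) (Fin 3) ℂ := Tm * mat g0 * Ti with hud
  have hu : uᴴ * Hc * u = Hc := by
    calc uᴴ * Hc * u = Tiᴴ * (mat g0)ᴴ * (Tmᴴ * Hc * Tm) * mat g0 * Ti := by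
          simp only [hud, Matrix.conjTranspose_mul, Matrix.mul_assoc]
      _ = Tiᴴ * ((mat g0)ᴴ * HodgeCM.PerL34.BallModel.J * mat g0) * Ti := by
          rw [hT']; simp only [Matrix.mul_assoc]
      _ = Hc := by rw [mat_mem g0, hHc']
  -- Part E
  have hclo := unitary_mem_closure L ι₁ V.Hm hH hdet u hu
  -- conjugate back by `T`
  let κ : Matrix (Fin 3) (Fin 3) ℂ → Matrix (Fin 3) (Fin 3) ℂ := fun M => Ti * M * Tm
  have hκ : Continuous κ := (continuous_const.mul continuous_id).mul continuous_const
  have hκu : κ u = mat g0 := by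
    simp only [κ, hud]
    calc Ti * (Tm * mat g0 * Ti) * Tm = (Ti * Tm) * mat g0 * (Ti * Tm) := by simp only [Matrix.mul_assoc]
      _ = mat g0 := by rw [hTT']; simp
  have hmem : mat g0 ∈ closure (κ '' {x : Matrix (Fin 3) (Fin 3) ℂ |
      ∃ g : GL (Fin 3) L, g ∈ unitaryGroup (conjRingHomK L) V.Hm ∧ (g : Matrix (Fin 3) (Fin 3) L).map ι₁ = x}) := by
    rw [← hκu]
    exact ContinuousWithinAt.mem_closure_image hκ.continuousWithinAt hclo
  have hsub : κ '' {x : Matrix (Fin 3) (Fin 3) ℂ |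
      ∃ g : GL (Fin 3) L, g ∈ unitaryGroup (conjRingHomK L) V.Hm ∧ (g : Matrix (Fin 3) (Fin 3) L).map ι₁ = x} ⊆
      mat '' Set.range (toU21 V T hT) := by
    rintro _ ⟨x, ⟨g, hg, rfl⟩, rfl⟩
    exact ⟨toU21 V T hT ⟨g, hg⟩, ⟨⟨g, hg⟩, rfl⟩, rfl⟩
  have hmem' : mat g0 ∈ closure (mat '' Set.range (toU21 V T hT)) := closure_mono hsub hmem
  rw [isInducing_mat.closure_eq_preimage_closure_image]
  exact hmem'

/-- **For the consumers** (`BallDictFacts.dense`, `FormsModelT.Print_dense`, `ThetaModel.BallFacts.dense` with the canonical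
`Δ := (toU21 V T hT).range` = the image of `G_U(L₀)` in `U(2,1)`): `Δ` is dense — unconditionally. -/
theorem _root_.HodgeCM.Literature.dense_range_toU21 (V : HermSpace3 L ι₁) (T : GL (Fin 3) ℂ)
    (hT : (T : Matrix (Fin 3) (Fin 3) ℂ)ᴴ * V.Hm.map ι₁ * (T : Matrix (Fin 3) (Fin 3) ℂ) = signatureMatrix 2) :
    Dense ((toU21 V T hT).range : Set U21) :=
  RealApproximation_GU_holds.dense_range V T hT

/-- The same with PerL's `Δ` as a `Subgroup U21` and a CHOSEN Sylvester frame (one exists by `HermSpace3.signature_ι₁`). -/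
theorem _root_.HodgeCM.Literature.exists_dense_image_GU (V : HermSpace3 L ι₁) :
    ∃ (T : GL (Fin 3) ℂ) (hT : (T : Matrix (Fin 3) (Fin 3) ℂ)ᴴ * V.Hm.map ι₁ * (T : Matrix (Fin 3) (Fin 3) ℂ) =
      signatureMatrix 2), Dense ((toU21 V T hT).range : Set U21) := by
  obtain ⟨T, hT⟩ := V.signature_ι₁
  exact ⟨T, hT, dense_range_toU21 V T hT⟩

end Transport

end RealApproximation

end HodgeCM.Literature

-- port_pkg: scope closed for this part
end
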